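import Literature.NumberTheory.Automorphic.UnitaryGroupBorelHeightBigCellTwo
import Literature.NumberTheory.Automorphic.UnitaryGroupTruncatedKernelHighCusp
import HarnessLib

/-!
# High in the cusp, `k^T = K − K_B` and `Λ^T φ = φ − φ_B` on `U(2)` (the `N = 2` twin of ★ `UnitaryGroupTruncatedKernelHighCusp`)
(Rogawski, *Automorphic Representations of Unitary Groups in Three Variables* (1990), §2.2, p. 13, with «`G = U(3)`, `U(2)`, or
`U(2) × U(1)`», p. 98; Garrett, *Modern Analysis of Automorphic Forms by Example* (2018), §1.5, §2.3 and §2.10)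

Topic `NumberTheory/Automorphic`; namespace `Literature.NumberTheory.Automorphic.UnitaryGroup`. THEOREMS
ONLY over accepted tree modules: no definition, no named fact, no `sorry`, no instance, no notation.
H-side copy of LAWS 1–5 for `H = U(Φ₂) × U(Φ₁)` (hodgecm-mathlib, F0P3a LEAD WORD #123; census
`CENSUS-LAWS-Hside` §3 LAW 1, sibling #2): the accepted ★ `UnitaryGroupTruncatedKernelHighCusp` has a
rank-generic §1 (`pseudoEisenstein_eq_self_of_forall_not_mem`, every `N`, reused here BY NAME) and a
`U(J₃)`-typed §2; this file re-types §2 for `U(J₂)` (★ `quasiSplit F E c 2`) over the `U(J₂)` Siegel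
property ★ `borelHeight_mul_borelHeight_le_one_of_not_mem_arithmeticBorel_two`
(★ `UnitaryGroupBorelHeightBigCellTwo`), proofs verbatim, names suffixed `_two`.

In `F`-rank one the pseudo-Eisenstein sums defining Arthur's truncation collapse to their `δ = 1`
term high in the cusp: by the HEIGHT DROP OFF THE BOREL (`H(γ g) · H(g) ≤ 1` for `γ ∈ G(F) ∖ B(F)` on
`U(J₂)`), if `1 ≤ T < H(g)` then `H(γ g) ≤ H(g)⁻¹ < T⁻¹ ≤ T` for every `γ ∉ B(F)`, so no cut-off
`1_{H(γ g) > T}` survives except on the trivial coset. Hence (`N = 2`, `1 ≤ T < H(g)`)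
`not_lt_borelHeight_mul_of_not_mem_arithmeticBorel_two`;
**`pseudoEisenstein_kernelBorelTail_eq_kernelBorel_two`** — `Σ_δ 1_{H(δg)>T} K_B(δg, δg) = K_B(g, g)`;
**`truncatedKernel_eq_kernel_sub_kernelBorel_two`** — `k^T(g) = K(g, g) − K_B(g, g)` (Rogawski (1990),
p. 13: on the Siegel domain the truncated kernel is `K − K_B`); and for a left-`B(F)`-invariant `φ`:
`pseudoEisenstein_constantTermTail_eq_borelConstantTerm_two`,
**`truncation_eq_self_sub_borelConstantTerm_two`** — `Λ^T φ(g) = φ(g) − φ_B(g)` (Garrett (2018), §2.10: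
«for `g` high in the Siegel set, `Λ^T φ = φ − c_P φ`»).
Every Haar measure `ν` of `N(𝔸_F)` and every fundamental domain `𝓕` of `N(F)` (these enter only through
the `B(F)`-invariance ★ `kernelBorel_diag_rational_borel_mul` / ★ `constantTermTail_rational_borel_mul`,
both every `N`); threshold constant ONE.

## References

* J. D. Rogawski, *Automorphic Representations of Unitary Groups in Three Variables*, Annals of
  Mathematics Studies 123 (1990), §2.2 (p. 13), §7.3 (p. 98) [Rogawski1990].
* P. Garrett, *Modern Analysis of Automorphic Forms by Example*, Cambridge Studies in Advanced
  Mathematics 173 (2018), §1.5, §2.3, §2.10 [Garrett2018].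
-/

set_option autoImplicit false

noncomputable section

open MeasureTheory Measure NumberField Set
open scoped NNReal

namespace Literature.NumberTheory.Automorphic

namespace UnitaryGroup

variable {F E : Type} [Field F] [NumberField F] [Field E] [NumberField E] [Algebra F E]
  {c : E ≃ₐ[F] E}


/-! ## `N = 2`: high in the cusp the truncation collapses to its `δ = 1` term -/

section Two

/-- **No non-Borel translate is high in the cusp**: for `γ ∈ G(F) ∖ B(F)` on `U(J₂)` and
`1 ≤ T < H(g)`, `¬ T < H(γ g)` (from ★ `H(γ g) · H(g) ≤ 1`: else `1 ≤ T² < H(γ g) H(g) ≤ 1`).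
[cite: Garrett2018, §1.5 and §2.3] -/
theorem not_lt_borelHeight_mul_of_not_mem_arithmeticBorel_two
    {γ : (quasiSplit F E c 2).arithmeticSubgroup} (hγ : γ ∉ arithmeticBorel F E c 2)
    {T : ℝ≥0} (hT : 1 ≤ T) {g : (quasiSplit F E c 2).Adelic} (hg : T < borelHeight g) :
    ¬T < borelHeight ((γ : (quasiSplit F E c 2).Adelic) * g) := by
  intro hγg
  have h1 := borelHeight_mul_borelHeight_le_one_of_not_mem_arithmeticBorel_two hγ g
  have hT0 : 0 < T := lt_of_lt_of_le one_pos hT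
  have h2 : T * T < borelHeight ((γ : (quasiSplit F E c 2).Adelic) * g) * borelHeight g :=
    mul_lt_mul'' hγg hg hT0.le hT0.le
  have h3 : (1 : ℝ≥0) ≤ T * T := one_le_mul_of_one_le_of_one_le hT hT
  exact absurd (h3.trans_lt (h2.trans_le h1)) (lt_irrefl 1)

variable [MeasurableSpace (adelicUnipotent F E c 2)] [BorelSpace (adelicUnipotent F E c 2)]

omit [BorelSpace (adelicUnipotent F E c 2)] in
/-- Hence the cut-off Borel diagonal vanishes at every non-Borel translate: `1_{H(γg) > T} K_B(γg, γg) = 0`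
for `γ ∉ B(F)`, `1 ≤ T < H(g)`. [cite: Rogawski1990, §2.2 (p. 13)] -/
theorem kernelBorelTail_mul_eq_zero_of_not_mem_arithmeticBorel_two (ν : Measure (adelicUnipotent F E c 2))
    (𝓕 : Set (adelicUnipotent F E c 2)) (f : (quasiSplit F E c 2).Adelic → ℂ)
    {γ : (quasiSplit F E c 2).arithmeticSubgroup} (hγ : γ ∉ arithmeticBorel F E c 2)
    {T : ℝ≥0} (hT : 1 ≤ T) {g : (quasiSplit F E c 2).Adelic} (hg : T < borelHeight g) :
    kernelBorelTail ν 𝓕 T f ((γ : (quasiSplit F E c 2).Adelic) * g) = 0 :=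
  kernelBorelTail_of_not_lt f (not_lt_borelHeight_mul_of_not_mem_arithmeticBorel_two hγ hT hg)

/-- **`Σ_δ 1_{H(δ g) > T} K_B(δ g, δ g) = K_B(g, g)` for `1 ≤ T < H(g)`** (`U(J₂)`; every Haar measure `ν`
of `N(𝔸_F)`, every fundamental domain `𝓕` of `N(F)`): only `δ ∈ B(F)` survives, and the diagonal of `K_B`
is `B(F)`-invariant (★ `kernelBorel_diag_rational_borel_mul`). [cite: Rogawski1990, §2.2 (p. 13)] -/
theorem pseudoEisenstein_kernelBorelTail_eq_kernelBorel_two (ν : Measure (adelicUnipotent F E c 2))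
    [ν.IsHaarMeasure] {𝓕 : Set (adelicUnipotent F E c 2)}
    (h𝓕 : IsFundamentalDomain (rationalUnipotent F E c 2) 𝓕 ν) (f : (quasiSplit F E c 2).Adelic → ℂ)
    {T : ℝ≥0} (hT : 1 ≤ T) {g : (quasiSplit F E c 2).Adelic} (hg : T < borelHeight g) :
    pseudoEisenstein (kernelBorelTail ν 𝓕 T f) g = kernelBorel ν 𝓕 f g g := by
  rw [pseudoEisenstein_eq_self_of_forall_not_mem
      (kernelBorelTail_rational_borel_mul (kernelBorel_diag_rational_borel_mul ν h𝓕 f) T) g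
      (fun γ hγ => kernelBorelTail_mul_eq_zero_of_not_mem_arithmeticBorel_two ν 𝓕 f hγ hT hg),
    kernelBorelTail_of_lt f hg]

/-- **High in the cusp Arthur's truncated kernel is `K − K_B`**: for `f` on `U(J₂)(𝔸_F)`, a Haar measure
`ν` of `N(𝔸_F)`, a fundamental domain `𝓕` of `N(F)` and `1 ≤ T < H(g)`:
`k^T(g) = K(g, g) − K_B(g, g)` (Rogawski (1990), §2.2 p. 13). [cite: Rogawski1990, §2.2 (p. 13)] -/
theorem truncatedKernel_eq_kernel_sub_kernelBorel_two (ν : Measure (adelicUnipotent F E c 2)) [ν.IsHaarMeasure]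
    {𝓕 : Set (adelicUnipotent F E c 2)} (h𝓕 : IsFundamentalDomain (rationalUnipotent F E c 2) 𝓕 ν)
    (f : (quasiSplit F E c 2).Adelic → ℂ) {T : ℝ≥0} (hT : 1 ≤ T) {g : (quasiSplit F E c 2).Adelic}
    (hg : T < borelHeight g) :
    truncatedKernel ν 𝓕 T f g = kernel f g g - kernelBorel ν 𝓕 f g g := by
  rw [truncatedKernel_def, pseudoEisenstein_kernelBorelTail_eq_kernelBorel_two ν h𝓕 f hT hg]

omit [BorelSpace (adelicUnipotent F E c 2)] in
/-- The cut-off constant term vanishes at every non-Borel translate: `c_B^T φ (γ g) = 0` for `γ ∉ B(F)`,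
`1 ≤ T < H(g)`. [cite: Garrett2018, §2.10 (PDF p. 119)] -/
theorem constantTermTail_mul_eq_zero_of_not_mem_arithmeticBorel_two (ν : Measure (adelicUnipotent F E c 2))
    (𝓕 : Set (adelicUnipotent F E c 2)) (φ : (quasiSplit F E c 2).Adelic → ℂ)
    {γ : (quasiSplit F E c 2).arithmeticSubgroup} (hγ : γ ∉ arithmeticBorel F E c 2)
    {T : ℝ≥0} (hT : 1 ≤ T) {g : (quasiSplit F E c 2).Adelic} (hg : T < borelHeight g) :
    constantTermTail ν 𝓕 T φ ((γ : (quasiSplit F E c 2).Adelic) * g) = 0 :=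
  constantTermTail_of_not_lt φ (not_lt_borelHeight_mul_of_not_mem_arithmeticBorel_two hγ hT hg)

/-- **`Σ_δ c_B^T φ(δ g) = φ_B(g)` for `1 ≤ T < H(g)`** and left-`B(F)`-invariant `φ` (`U(J₂)`; every Haar `ν`,
every fundamental domain `𝓕`; ★ `constantTermTail_rational_borel_mul`). [cite: Garrett2018, §2.10 (PDF p. 119)] -/
theorem pseudoEisenstein_constantTermTail_eq_borelConstantTerm_two (ν : Measure (adelicUnipotent F E c 2))
    [ν.IsHaarMeasure] {𝓕 : Set (adelicUnipotent F E c 2)}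
    (h𝓕 : IsFundamentalDomain (rationalUnipotent F E c 2) 𝓕 ν) {φ : (quasiSplit F E c 2).Adelic → ℂ}
    (hφ : ∀ b ∈ arithmeticBorel F E c 2, ∀ x : (quasiSplit F E c 2).Adelic,
      φ ((b : (quasiSplit F E c 2).Adelic) * x) = φ x)
    {T : ℝ≥0} (hT : 1 ≤ T) {g : (quasiSplit F E c 2).Adelic} (hg : T < borelHeight g) :
    pseudoEisenstein (constantTermTail ν 𝓕 T φ) g = borelConstantTerm ν 𝓕 φ g := by
  rw [pseudoEisenstein_eq_self_of_forall_not_mem (constantTermTail_rational_borel_mul ν h𝓕 T hφ) g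
      (fun γ hγ => constantTermTail_mul_eq_zero_of_not_mem_arithmeticBorel_two ν 𝓕 φ hγ hT hg),
    constantTermTail_of_lt φ hg]

/-- **High in the cusp Arthur's truncation is `φ − φ_B`**: for left-`B(F)`-invariant `φ` on `U(J₂)(𝔸_F)`
(in particular automorphic `φ`), a Haar `ν`, a fundamental domain `𝓕` and `1 ≤ T < H(g)`:
`Λ^T φ(g) = φ(g) − φ_B(g)` (Garrett (2018), §2.10). [cite: Garrett2018, §2.10 (PDF p. 119)] -/
theorem truncation_eq_self_sub_borelConstantTerm_two (ν : Measure (adelicUnipotent F E c 2)) [ν.IsHaarMeasure]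
    {𝓕 : Set (adelicUnipotent F E c 2)} (h𝓕 : IsFundamentalDomain (rationalUnipotent F E c 2) 𝓕 ν)
    {φ : (quasiSplit F E c 2).Adelic → ℂ}
    (hφ : ∀ b ∈ arithmeticBorel F E c 2, ∀ x : (quasiSplit F E c 2).Adelic,
      φ ((b : (quasiSplit F E c 2).Adelic) * x) = φ x)
    {T : ℝ≥0} (hT : 1 ≤ T) {g : (quasiSplit F E c 2).Adelic} (hg : T < borelHeight g) :
    truncation ν 𝓕 T φ g = φ g - borelConstantTerm ν 𝓕 φ g := by
  rw [truncation_def, pseudoEisenstein_constantTermTail_eq_borelConstantTerm_two ν h𝓕 hφ hT hg]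

/-- In particular for a left-`G(F)`-invariant (e.g. automorphic) `φ`. [cite: Garrett2018, §2.10 (PDF p. 119)] -/
theorem truncation_eq_self_sub_borelConstantTerm_of_rational_invariant_two
    (ν : Measure (adelicUnipotent F E c 2)) [ν.IsHaarMeasure] {𝓕 : Set (adelicUnipotent F E c 2)}
    (h𝓕 : IsFundamentalDomain (rationalUnipotent F E c 2) 𝓕 ν) {φ : (quasiSplit F E c 2).Adelic → ℂ}
    (hφ : ∀ γ : (quasiSplit F E c 2).arithmeticSubgroup, ∀ x : (quasiSplit F E c 2).Adelic,
      φ ((γ : (quasiSplit F E c 2).Adelic) * x) = φ x)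
    {T : ℝ≥0} (hT : 1 ≤ T) {g : (quasiSplit F E c 2).Adelic} (hg : T < borelHeight g) :
    truncation ν 𝓕 T φ g = φ g - borelConstantTerm ν 𝓕 φ g :=
  truncation_eq_self_sub_borelConstantTerm_two ν h𝓕 (fun b _ x => hφ b x) hT hg

end Two

end UnitaryGroup

end Literature.NumberTheory.Automorphic
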